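import Summits.CriticalPhenomena.SAWScalingLimit.Theorems.SAWReversalUpgradeAttachReversalReversalC

/-!
# Attachment reversal: constant polylines, and the absence of cut-time plateaus

Helper file for item `AttachReversal` of route `SAWReversalUpgrade` (stmt-CriticalPhenomena-18007).

* `const_snd_uMid_vMid`, `not_lt_of_const_fst` — for a CONSTANT polyline sitting at one of the two
  marked points the cut-time condition `uMid < vMid` fails (so the attachment is the fallback arc);
  this covers the trivial walk at a marked lattice point;
* `uMid_mem_Icc`, `vMid_mem_Icc` — the cut times lie in `[0, 1]`;
* `not_uMid_vMid_eq_one` — **no plateau at the end**: for a continuous `U` in `closure D` with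
  `U 0 ≠ b`, `U 1 ≠ a` and `U 0 ≠ U 1`, it is impossible that `uMid = vMid = 1` (that would force
  the access and exit crossings to coincide with `Z 1 = Φ q`, whence `p = q` and `U i = U j`, i.e.
  `U 0 = U 1`);
* `lt_of_repar_lt` — consequently strict order of the cut times passes from a reparametrised
  polyline `U ∘ h` back to `U` whenever `h` is injective off its top plateau
  (`h u = h v, u < v ⇒ h u = 1`), as is the dyadic time change of the tree's polylines.
-/

noncomputable section

open Set Function Filter Topology Complex
open UpperHalfPlane (upperHalfPlaneSet)
open Literature.Probability.RandomPlanarGeometry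

namespace Summit.CriticalPhenomena.SAWScalingLimit.Theorems.AttachReversal

/-! ### Infima and suprema of subsets of a point -/

/-- A set of reals contained in `{x}` has infimum `x` or is empty; with `sInf ∅ = 0` and `x = 0` both
give `0`; in general we only need: `S ⊆ {x}` implies `sInf S = x` when `S` is nonempty. -/
theorem sInf_eq_of_subset_singleton {S : Set ℝ} {x : ℝ} (hS : S ⊆ {x}) (hne : S.Nonempty) : sInf S = x := by
  rw [hne.subset_singleton_iff.1 hS, csInf_singleton]

/-- `sSup S ≤ x` for `S ⊆ {x}` with `0 ≤ x`. -/
theorem sSup_le_of_subset_singleton {S : Set ℝ} {x : ℝ} (hS : S ⊆ {x}) (hx : 0 ≤ x) : sSup S ≤ x := by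
  rcases S.eq_empty_or_nonempty with rfl | hne
  · rw [Real.sSup_empty]; exact hx
  · rw [hne.subset_singleton_iff.1 hS, csSup_singleton]

/-- `sInf S ∈ {0, x}`-type bound: for `S ⊆ {x}`, `sInf S = 0 ∨ sInf S = x`. -/
theorem sInf_of_subset_singleton {S : Set ℝ} {x : ℝ} (hS : S ⊆ {x}) : sInf S = 0 ∨ sInf S = x := by
  rcases S.eq_empty_or_nonempty with rfl | hne
  · exact Or.inl Real.sInf_empty
  · exact Or.inr (sInf_eq_of_subset_singleton hS hne)

/-- For `S ⊆ {x}`, `sSup S = 0 ∨ sSup S = x`. -/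
theorem sSup_of_subset_singleton {S : Set ℝ} {x : ℝ} (hS : S ⊆ {x}) : sSup S = 0 ∨ sSup S = x := by
  rcases S.eq_empty_or_nonempty with rfl | hne
  · exact Or.inl Real.sSup_empty
  · rw [hne.subset_singleton_iff.1 hS, csSup_singleton]; exact Or.inr rfl

/-! ### Constant polylines at a marked point -/

section Const

variable {x y : ℂ} {Φ : ℂ → ℂ} {e : ℝ}

/-- The visit times of the constant polyline at `y ≠ x`: never at `x`, always at `y`. -/
theorem lastA_firstB_const_snd (hxy : x ≠ y) :
    lastA x (fun _ : ℝ => y) = 0 ∧ firstB y (fun _ : ℝ => y) = 0 := by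
  constructor
  · unfold lastA
    have : {u : ℝ | u ∈ Icc (0:ℝ) 1 ∧ (fun _ : ℝ => y) u = x} = ∅ := by
      ext u; simp only [mem_setOf_eq, mem_empty_iff_false, iff_false, not_and]
      exact fun _ h => hxy h.symm
    rw [this, union_empty, csSup_singleton]
  · unfold firstB
    have : {u : ℝ | u ∈ Icc (0:ℝ) 1 ∧ (fun _ : ℝ => y) u = y} = Icc 0 1 := by
      ext u; simp only [mem_setOf_eq, and_true]
    rw [this, union_eq_self_of_subset_left (singleton_subset_iff.2
      (show (1:ℝ) ∈ Icc (0:ℝ) 1 from ⟨zero_le_one, le_rfl⟩)), csInf_Icc zero_le_one]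

/-- **Constant polyline at the second marked point**: `uMid = vMid = 0`. -/
theorem const_snd_uMid_vMid (hxy : x ≠ y) :
    uMid x y Φ e (fun _ : ℝ => y) = 0 ∧ vMid x y Φ e (fun _ : ℝ => y) = 0 := by
  obtain ⟨hi, hj⟩ := lastA_firstB_const_snd hxy
  constructor
  · unfold uMid
    rw [hi, hj, Icc_self]
    rcases sInf_of_subset_singleton (S := {u : ℝ | u ∈ ({0} : Set ℝ) ∧
        attZ y Φ e (fun _ : ℝ => y) u = Φ ((sAcc x y Φ e (fun _ : ℝ => y) : ℂ) * pAcc x Φ e fun _ : ℝ => y)})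
        (x := 0) (fun u hu => hu.1) with h | h <;> exact h
  · unfold vMid
    rw [hi, hj, Icc_self]
    have hsub : {u : ℝ | u ∈ ({0} : Set ℝ) ∧ (fun _ : ℝ => y) (0:ℝ) = y ∧ u = 0} ∪
        {u : ℝ | u ∈ ({0} : Set ℝ) ∧ (fun _ : ℝ => y) (0:ℝ) ≠ y ∧
          attZ y Φ e (fun _ : ℝ => y) u = Φ ((rEx x y Φ e (fun _ : ℝ => y) : ℂ) * qEx y Φ e fun _ : ℝ => y)} ⊆
        {0} := by
      rintro u (⟨hu, -⟩ | ⟨hu, -⟩) <;> exact hu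
    rcases sSup_of_subset_singleton hsub with h | h <;> exact h

/-- The visit times of the constant polyline at `x ≠ y`: always at `x`, never at `y`. -/
theorem lastA_firstB_const_fst (hxy : x ≠ y) :
    lastA x (fun _ : ℝ => x) = 1 ∧ firstB y (fun _ : ℝ => x) = 1 := by
  constructor
  · unfold lastA
    have : {u : ℝ | u ∈ Icc (0:ℝ) 1 ∧ (fun _ : ℝ => x) u = x} = Icc 0 1 := by
      ext u; simp only [mem_setOf_eq, and_true]
    rw [this, union_eq_self_of_subset_left (singleton_subset_iff.2
      (show (0:ℝ) ∈ Icc (0:ℝ) 1 from ⟨le_rfl, zero_le_one⟩)), csSup_Icc zero_le_one]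
  · unfold firstB
    have : {u : ℝ | u ∈ Icc (0:ℝ) 1 ∧ (fun _ : ℝ => x) u = y} = ∅ := by
      ext u; simp only [mem_setOf_eq, mem_empty_iff_false, iff_false, not_and]
      exact fun _ h => hxy h
    rw [this, union_empty, csInf_singleton]

/-- **Constant polyline at the first marked point**: the cut-time condition fails, provided the push
map fixes the point (`Φ 0 = x`, `ψ x = 0`, `A_e 0 = 0`): then `Z ≡ x`, `uMid = 1 ≥ vMid`. -/
theorem not_lt_of_const_fst (hxy : x ≠ y) (hΦ0 : Φ 0 = x) (hψ : hinv Φ x = 0) (hsq : squeeze e 0 = 0) :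
    ¬ uMid x y Φ e (fun _ : ℝ => x) < vMid x y Φ e (fun _ : ℝ => x) := by
  obtain ⟨hi, hj⟩ := lastA_firstB_const_fst hxy
  have hZ : ∀ u, attZ y Φ e (fun _ : ℝ => x) u = x := fun u => by
    rw [attZ_of_ne (show (fun _ : ℝ => x) u ≠ y from hxy), hψ, hsq, hΦ0]
  have hp : pAcc x Φ e (fun _ : ℝ => x) = 0 := by unfold pAcc; rw [hψ, hsq]
  have hu : uMid x y Φ e (fun _ : ℝ => x) = 1 := by
    unfold uMid
    rw [hi, hj, Icc_self, hp, mul_zero, hΦ0]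
    refine sInf_eq_of_subset_singleton (fun u hu => hu.1) ⟨1, rfl, hZ 1⟩
  have hv : vMid x y Φ e (fun _ : ℝ => x) ≤ 1 := by
    unfold vMid
    rw [hi, hj, Icc_self]
    refine sSup_le_of_subset_singleton ?_ zero_le_one
    rintro u (⟨hu, -⟩ | ⟨hu, -⟩) <;> exact hu
  rw [hu]
  exact not_lt.2 hv

end Const

/-! ### The cut times lie in `[0, 1]` -/

section Bounds

variable {x y : ℂ} {Φ : ℂ → ℂ} {e : ℝ} {R : ℝ → ℂ}

/-- `uMid ∈ [0, 1]`. -/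
theorem uMid_mem_Icc (x y : ℂ) (Φ : ℂ → ℂ) (e : ℝ) (R : ℝ → ℂ) : uMid x y Φ e R ∈ Icc (0:ℝ) 1 := by
  unfold uMid
  obtain ⟨S, hS⟩ : ∃ S : Set ℝ, S = {u : ℝ | u ∈ Icc (lastA x R) (firstB y R) ∧
      attZ y Φ e R u = Φ ((sAcc x y Φ e R : ℂ) * pAcc x Φ e R)} := ⟨_, rfl⟩
  rw [← hS]
  have hsub : S ⊆ Icc 0 1 := fun u hu => Icc_lastA_firstB_subset x y R (by rw [hS] at hu; exact hu.1)
  rcases S.eq_empty_or_nonempty with rfl | hne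
  · rw [Real.sInf_empty]; exact ⟨le_rfl, zero_le_one⟩
  · have hbdd : BddBelow S := ⟨0, fun u hu => (hsub hu).1⟩
    obtain ⟨u, hu⟩ := hne
    exact ⟨le_csInf ⟨u, hu⟩ fun v hv => (hsub hv).1, (csInf_le hbdd hu).trans (hsub hu).2⟩

/-- `vMid ∈ [0, 1]`. -/
theorem vMid_mem_Icc (x y : ℂ) (Φ : ℂ → ℂ) (e : ℝ) (R : ℝ → ℂ) : vMid x y Φ e R ∈ Icc (0:ℝ) 1 := by
  unfold vMid
  obtain ⟨S, hS⟩ : ∃ S : Set ℝ, S = {u : ℝ | u ∈ Icc (lastA x R) (firstB y R) ∧ R (firstB y R) = y ∧ u = firstB y R} ∪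
      {u : ℝ | u ∈ Icc (lastA x R) (firstB y R) ∧ R (firstB y R) ≠ y ∧
        attZ y Φ e R u = Φ ((rEx x y Φ e R : ℂ) * qEx y Φ e R)} := ⟨_, rfl⟩
  rw [← hS]
  have hsub : S ⊆ Icc 0 1 := by
    rw [hS]; rintro u (⟨hu, -⟩ | ⟨hu, -⟩) <;> exact Icc_lastA_firstB_subset x y R hu
  rcases S.eq_empty_or_nonempty with rfl | hne
  · rw [Real.sSup_empty]; exact ⟨le_rfl, zero_le_one⟩
  · have hbdd : BddAbove S := ⟨1, fun u hu => (hsub hu).2⟩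
    obtain ⟨u, hu⟩ := hne
    exact ⟨(hsub hu).1.trans (le_csSup hbdd hu), csSup_le ⟨u, hu⟩ fun v hv => (hsub hv).2⟩

end Bounds

/-! ### No plateau of the cut times at the end of the trimmed interval -/

variable {D : DobrushinDomain} {φ : ConformalEquiv upperHalfPlaneSet D.carrier} {e : ℝ} {U : ℝ → ℂ}

/-- **No cut-time plateau at the end.** For a continuous `U` in `closure D` with `U 0 ≠ b`, `U 1 ≠ a`
and `U 0 ≠ U 1`, it is impossible that `uMid = vMid = 1`. -/
theorem not_uMid_vMid_eq_one (hφ : D.IsChordalUniformizing φ) (he : 0 < e) (he' : e ≤ 1 / 2)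
    (hU : Continuous U) (hcl : ∀ s, U s ∈ closure D.carrier) (h0b : U 0 ≠ D.pt 1) (h1a : U 1 ≠ D.pt 0)
    (h01 : U 0 ≠ U 1) :
    ¬ (uMid (D.pt 0) (D.pt 1) φ.boundaryExtension e U = 1 ∧ vMid (D.pt 0) (D.pt 1) φ.boundaryExtension e U = 1) := by
  rintro ⟨hu1, hv1⟩
  have hij : lastA (D.pt 0) U ≤ firstB (D.pt 1) U := by
    by_contra h
    have := uMid_vMid_of_lt (Φ := φ.boundaryExtension) (e := e) (not_le.1 h)
    rw [this.1] at hu1; exact zero_ne_one hu1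
  have hj1 : firstB (D.pt 1) U ≤ 1 := (firstB_mem_Icc (D.pt 1) U).2
  obtain ⟨φ', -⟩ := MarkedDomain.exists_isChordalUniformizing_holds D.swap
  by_cases hia : U (lastA (D.pt 0) U) = D.pt 0
  · obtain ⟨-, -, hu, -⟩ := rev_of_firstA hφ φ' he he' hcl hij hia
    rw [hu] at hu1
    have hj : firstB (D.pt 1) U = 1 := le_antisymm hj1 (hu1 ▸ hij)
    rw [hu1] at hia
    exact h1a hia
  obtain ⟨hs01, hsM, hsmin, hp⟩ := access_spec hφ he he' hU hcl h0b hij hia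
  have hi0 : lastA (D.pt 0) U = 0 := lastA_eq_zero_of_ne hU hia
  -- the set behind `uMid` is `{1}`: its infimum is `1` and it lies in `[0, 1]`
  obtain ⟨t, ht, htX⟩ := hsM
  have ht1 : t = 1 := by
    have hle : uMid (D.pt 0) (D.pt 1) φ.boundaryExtension e U ≤ t :=
      csInf_le ⟨lastA (D.pt 0) U, fun u hu => hu.1.1⟩ ⟨ht, htX.symm ▸ rfl⟩
    rw [hu1] at hle
    exact le_antisymm (ht.2.trans hj1) hle
  subst ht1
  have hj : firstB (D.pt 1) U = 1 := le_antisymm hj1 ht.2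
  -- `X = Z 1`
  by_cases hjb : U (firstB (D.pt 1) U) = D.pt 1
  · -- then `Z 1 = b`, but `X = Φ (s p)` is a value of `Φ` on `ℍ̄`
    rw [hj] at hjb
    rw [attZ_of_eq hjb] at htX
    exact FaithfulAttach.bext_ne_pt_one hφ (ray_im_nonneg hp.le hs01.1.le) htX.symm
  obtain ⟨hr1, hrM, hrmax, hq⟩ := exit_spec hφ he he' hU hcl h1a hij hjb
  -- the set behind `vMid` (guard `U j ≠ b` true) is closed, so `vMid = 1` is attained: `Z 1 = Y`
  have hV : IsClosed {u : ℝ | u ∈ Icc (lastA (D.pt 0) U) (firstB (D.pt 1) U) ∧ U (firstB (D.pt 1) U) ≠ D.pt 1 ∧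
      attZ (D.pt 1) φ.boundaryExtension e U u =
        φ.boundaryExtension ((rEx (D.pt 0) (D.pt 1) φ.boundaryExtension e U : ℂ) * qEx (D.pt 1) φ.boundaryExtension e U)} := by
    have hc := continuousOn_attZ hφ he he' hU (S := Icc (lastA (D.pt 0) U) (firstB (D.pt 1) U)) fun t _ => hcl t
    have := hc.preimage_isClosed_of_isClosed isClosed_Icc (isClosed_singleton (x :=
      φ.boundaryExtension ((rEx (D.pt 0) (D.pt 1) φ.boundaryExtension e U : ℂ) * qEx (D.pt 1) φ.boundaryExtension e U)))
    convert this using 1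
    ext u; simp only [mem_setOf_eq, mem_inter_iff, mem_preimage, mem_singleton_iff]
    exact ⟨fun h => ⟨h.1, h.2.2⟩, fun h => ⟨h.1, hjb, h.2⟩⟩
  have hV1 : (1:ℝ) ∈ {u : ℝ | u ∈ Icc (lastA (D.pt 0) U) (firstB (D.pt 1) U) ∧ U (firstB (D.pt 1) U) ≠ D.pt 1 ∧
      attZ (D.pt 1) φ.boundaryExtension e U u =
        φ.boundaryExtension ((rEx (D.pt 0) (D.pt 1) φ.boundaryExtension e U : ℂ) * qEx (D.pt 1) φ.boundaryExtension e U)} := by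
    obtain ⟨t', ht', ht'Y⟩ := hrM
    have hne : ({u : ℝ | u ∈ Icc (lastA (D.pt 0) U) (firstB (D.pt 1) U) ∧ U (firstB (D.pt 1) U) ≠ D.pt 1 ∧
        attZ (D.pt 1) φ.boundaryExtension e U u =
          φ.boundaryExtension ((rEx (D.pt 0) (D.pt 1) φ.boundaryExtension e U : ℂ) *
            qEx (D.pt 1) φ.boundaryExtension e U)}).Nonempty := ⟨t', ht', hjb, ht'Y⟩
    have hbdd : BddAbove {u : ℝ | u ∈ Icc (lastA (D.pt 0) U) (firstB (D.pt 1) U) ∧ U (firstB (D.pt 1) U) ≠ D.pt 1 ∧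
        attZ (D.pt 1) φ.boundaryExtension e U u =
          φ.boundaryExtension ((rEx (D.pt 0) (D.pt 1) φ.boundaryExtension e U : ℂ) *
            qEx (D.pt 1) φ.boundaryExtension e U)} := ⟨firstB (D.pt 1) U, fun u hu => hu.1.2⟩
    have hmem := hV.csSup_mem hne hbdd
    have hv : vMid (D.pt 0) (D.pt 1) φ.boundaryExtension e U = sSup {u : ℝ | u ∈ Icc (lastA (D.pt 0) U) (firstB (D.pt 1) U) ∧
        U (firstB (D.pt 1) U) ≠ D.pt 1 ∧ attZ (D.pt 1) φ.boundaryExtension e U u =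
          φ.boundaryExtension ((rEx (D.pt 0) (D.pt 1) φ.boundaryExtension e U : ℂ) *
            qEx (D.pt 1) φ.boundaryExtension e U)} := by
      unfold vMid
      have h1 : {u : ℝ | u ∈ Icc (lastA (D.pt 0) U) (firstB (D.pt 1) U) ∧ U (firstB (D.pt 1) U) = D.pt 1 ∧
          u = firstB (D.pt 1) U} = ∅ := by
        ext u; simp only [mem_setOf_eq, mem_empty_iff_false, iff_false, not_and]
        exact fun _ h _ => hjb h
      rw [h1, empty_union]
    rw [← hv, hv1] at hmem
    exact hmem
  obtain ⟨-, -, h1Y⟩ := hV1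
  -- so `Φ (s p) = Z 1 = Φ (r q) = Φ q`
  have hZ1 : attZ (D.pt 1) φ.boundaryExtension e U 1 = φ.boundaryExtension (qEx (D.pt 1) φ.boundaryExtension e U) := by
    rw [← hj]; exact attZ_firstB_of_ne hjb
  have hinj := FaithfulAttach.bext_injOn (D := D) φ
  have hq0 : qEx (D.pt 1) φ.boundaryExtension e U ≠ 0 := by intro h; rw [h] at hq; simp at hq
  -- `r q = q`, so `r = 1`
  have hr : rEx (D.pt 0) (D.pt 1) φ.boundaryExtension e U = 1 := by
    have h := hinj (ray_im_nonneg hq.le (zero_le_one.trans hr1)) hq.le (h1Y.symm.trans hZ1)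
    have h' : ((rEx (D.pt 0) (D.pt 1) φ.boundaryExtension e U : ℝ) : ℂ) = 1 := by
      have := mul_right_cancel₀ hq0 (h.trans (one_mul _).symm)
      exact this
    exact_mod_cast h'
  -- `s p = q`, so `Φ p = Φ (s⁻¹ q) ∈ M` with `s⁻¹ ≥ 1`, whence `s⁻¹ ≤ r = 1`, `s = 1`, `p = q`
  have hsp : ((sAcc (D.pt 0) (D.pt 1) φ.boundaryExtension e U : ℝ) : ℂ) * pAcc (D.pt 0) φ.boundaryExtension e U =
      qEx (D.pt 1) φ.boundaryExtension e U :=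
    hinj (ray_im_nonneg hp.le hs01.1.le) hq.le (htX.symm.trans hZ1)
  have hib : U (lastA (D.pt 0) U) ≠ D.pt 1 := by rw [hi0]; exact h0b
  have hpM : φ.boundaryExtension ((((sAcc (D.pt 0) (D.pt 1) φ.boundaryExtension e U)⁻¹ : ℝ) : ℂ) *
      qEx (D.pt 1) φ.boundaryExtension e U) ∈ midSet (D.pt 0) (D.pt 1) φ.boundaryExtension e U := by
    have : (((sAcc (D.pt 0) (D.pt 1) φ.boundaryExtension e U)⁻¹ : ℝ) : ℂ) * qEx (D.pt 1) φ.boundaryExtension e U =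
        pAcc (D.pt 0) φ.boundaryExtension e U := by
      rw [← hsp, ← mul_assoc, ← Complex.ofReal_mul, inv_mul_cancel₀ hs01.1.ne', Complex.ofReal_one, one_mul]
    rw [this, ← attZ_lastA_of_ne hib]
    exact mem_image_of_mem _ ⟨le_rfl, hij⟩
  have hs1 : sAcc (D.pt 0) (D.pt 1) φ.boundaryExtension e U = 1 := by
    have h := hrmax _ ((one_le_inv₀ hs01.1).2 hs01.2) hpM
    rw [hr] at h
    exact le_antisymm hs01.2 ((inv_le_one₀ hs01.1).1 h)
  have hpq : pAcc (D.pt 0) φ.boundaryExtension e U = qEx (D.pt 1) φ.boundaryExtension e U := by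
    rw [← hsp, hs1, Complex.ofReal_one, one_mul]
  -- `p = q` forces `U i = U j`, i.e. `U 0 = U 1`
  have hja : U (firstB (D.pt 1) U) ≠ D.pt 0 := by rw [hj]; exact h1a
  have hψ : hinv φ.boundaryExtension (U (lastA (D.pt 0) U)) = hinv φ.boundaryExtension (U (firstB (D.pt 1) U)) :=
    sqz_injOn he he' (squeeze_spec' e) (hinv_im_nonneg hφ (hcl _) hib) (hinv_im_nonneg hφ (hcl _) hjb) hpq
  have hU01 : U (lastA (D.pt 0) U) = U (firstB (D.pt 1) U) := by
    rw [← bExt_hinv hφ (hcl _) hib, hψ, bExt_hinv hφ (hcl _) hjb]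
  rw [hi0, hj] at hU01
  exact h01 hU01

/-- **Strict order of the cut times passes back through a time change without interior plateaus.**
If `h` is continuous, monotone, `h 0 = 0`, `h 1 = 1`, injective off its top plateau on `[0, 1]`
(`u < v`, `h u = h v` forces `h u = 1`), and `U` admits no end plateau (`not_uMid_vMid_eq_one`), then
`uMid (U ∘ h) < vMid (U ∘ h)` implies `uMid U < vMid U`. -/
theorem lt_of_repar_lt (hφ : D.IsChordalUniformizing φ) (he : 0 < e) (he' : e ≤ 1 / 2)
    (hU : Continuous U) (hcl : ∀ s, U s ∈ closure D.carrier) (h0b : U 0 ≠ D.pt 1) (h1a : U 1 ≠ D.pt 0)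
    (h01 : U 0 ≠ U 1) {h : ℝ → ℝ} (hh : Continuous h) (hmono : Monotone h) (h0 : h 0 = 0) (h1 : h 1 = 1)
    (hplat : ∀ u v : ℝ, u ∈ Icc (0:ℝ) 1 → v ∈ Icc (0:ℝ) 1 → u < v → h u = h v → h u = 1)
    (hlt : uMid (D.pt 0) (D.pt 1) φ.boundaryExtension e (U ∘ h) < vMid (D.pt 0) (D.pt 1) φ.boundaryExtension e (U ∘ h)) :
    uMid (D.pt 0) (D.pt 1) φ.boundaryExtension e U < vMid (D.pt 0) (D.pt 1) φ.boundaryExtension e U := by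
  have hab : D.pt 0 ≠ D.pt 1 := D.pt_injective.ne (by decide)
  have hu := repar_uMid hh hmono h0 h1 hab hU (Φ := φ.boundaryExtension) (e := e)
  have hv := repar_vMid hh hmono h0 h1 hab hU (Φ := φ.boundaryExtension) (e := e)
  rw [← hu, ← hv]
  rcases (hmono hlt.le).lt_or_eq with hlt' | heq'
  · exact hlt'
  · exfalso
    have h1' := hplat _ _ (uMid_mem_Icc _ _ _ _ _) (vMid_mem_Icc _ _ _ _ _) hlt heq'
    refine not_uMid_vMid_eq_one hφ he he' hU hcl h0b h1a h01 ⟨?_, ?_⟩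
    · rw [← hu, h1']
    · rw [← hv, ← heq', h1']

end Summit.CriticalPhenomena.SAWScalingLimit.Theorems.AttachReversal

end
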